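import Summits.Ventures.LatticeQCDFlow.Exactness.FlowSamplerExact
import Summits.Ventures.LatticeQCDFlow.Scoring.SchwingerDysonPhi4GibbsMonomial
import Literature.Probability.MarkovChains.DoeblinMinorization
import HarnessLib

/-!
# The φ⁴ flow sampler is uniformly ergodic whenever the model's tails are at least Gaussian

HONEST FRAMING: exact (Metropolis-corrected) sampling algorithms for lattice gauge theory;
figures of merit are autocorrelation/cost numbers at stated couplings and volumes; no
continuum-physics claim.  (SCALAR calibration rung S0-A: not a gauge result.)

Venture `LatticeQCDFlow` (cell pub-lqcd), topic `Exactness`; FANOUT row 2 (`s0-phi4`, the FLOW arm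
of the 2D φ⁴ calibration: real-NVP proposals + independence-Metropolis accept/reject, Albergo–
Kanwar–Shanahan 2019).  NEW WORK of the cell, composed over the tree: row 30's general-state-space
flow-MCMC kernel (`Exactness/IMHKernel.lean`: `indepMH`, its Doeblin minorisation for a bounded
weight `indepMH_apply_ge`; `Exactness/FlowSamplerExact.lean`: densities against a reference
volume), the Literature formalisation of Doeblin's theorem
(`Literature.Probability.MarkovChains.Doeblin.doeblin_iterate_sub_invariant_le`, Meyn–Tweedie
Thm 16.2.4), and row 2's lattice φ⁴ Gibbs weight (`Scoring/SchwingerDysonPhi4Gibbs*.lean`).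
Printed counterparts, NAMED ONLY (nothing is cited as a fact): Mengersen–Tweedie 1996, Ann.
Statist. 24, Thm 2.1 (the independence sampler is uniformly ergodic iff the importance weight is
essentially bounded, rate `(1 − 1/W)ᵗ`); Tierney 1994 §3; Meyn–Tweedie 1993 Thm 16.2.4.

`Exactness/Phi4IndependenceSamplerExact.lean` (row 2) typed EXACTNESS of the flow sampler for every
positive model density and left "irreducibility / geometric ergodicity (needs `sup p/q < ∞`)" NOT
CLAIMED.  This file closes that gap in the direction that matters for the S0-A flows.

## What is proved

* §1 (general state space `Ω`, reference volume `vol`, target density `p`, model density `q̃`,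
  both positive and measurable, `p · vol` and `q̃ · vol` probability laws).
  `indepMH_const_mul` — the kernel only sees weight RATIOS (`indepMH q (c·w) = indepMH q w`);
  `flowMCMC_minorisation` — `p ≤ M q̃` pointwise gives Doeblin `K(x, ·) ≥ M⁻¹ π(·)` from EVERY
  state; **`flowMCMC_uniformly_ergodic`** — hence for every initial law `μ`, every `t` and every
  set `A`: `|μKᵗ(A) − π(A)| ≤ (1 − M⁻¹)ᵗ` (and `M ≥ 1` automatically).
* §2 (the lattice `ℝ^Λ`, `Λ = Fin (n+1)`).  `phi4GibbsMeasure J λ = Z⁻¹ e^{−S} dφ` IS a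
  probability measure for `λ > 0` (`isProbabilityMeasure_phi4GibbsMeasure`) whose expectations are
  row 2's `gibbsExpect` (`integral_phi4GibbsMeasure`); `flowModel q̃ = q̃ dφ` is one for a positive
  density integrating to one; `phi4FlowKernel J λ q̃ = indepMH (q̃ dφ) (e^{−S}/q̃)` is the S0-A flow
  sampler with the weights the code evaluates (un-normalised `e^{−S}`).
  **`phi4FlowSampler_uniformly_ergodic`** — for every `λ > 0`, every real coupling matrix `J`
  (the AKS 2019 sets `m² = −4` included), every model density with `e^{−S} ≤ W·Z·q̃`
  (`sup (Z⁻¹e^{−S})/q̃ ≤ W`): the flow sampler leaves `phi4GibbsMeasure` invariant AND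
  `|μKᵗ(A) − π(A)| ≤ (1 − W⁻¹)ᵗ` from every initial law, every `t`, every set `A`.
  The companion `Exactness/Phi4FlowSamplerGaussianMinorant.lean` discharges the weight bound from
  a Gaussian minorant of the model density (`q̃ ≥ c e^{−κΣφ²}` ⇒ `W⁻¹ = c Z e^{−K}`, explicit `K`),
  which affine-coupling flows with bounded log-scales have; a flow whose output tails are LIGHTER
  than `e^{−S}` somewhere has `W = ∞`, and then Mengersen–Tweedie's converse (named only) says the
  exact chain is not even geometrically ergodic — exactness ≠ ergodicity.

NOT CLAIMED: the converse direction as a theorem; spectral gaps / autocorrelation times of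
specific observables; anything about a trained network's actual constant `W`.
-/

namespace Summit.Ventures.LatticeQCDFlow.Exactness

open MeasureTheory ProbabilityTheory Real Finset
open scoped ENNReal

/-! ## §1. General state space: a bounded importance weight gives uniform ergodicity -/

section General

variable {Ω : Type*} [MeasurableSpace Ω]

omit [MeasurableSpace Ω] in
/-- The acceptance probability only depends on weight ratios: rescaling the weight by a positive
constant (e.g. normalising the target) does not change it. -/
theorem imhAccept_const_mul {w : Ω → ℝ} {c : ℝ} (hc : 0 < c) :
    imhAccept (fun x => c * w x) = imhAccept w := by
  funext x y
  unfold imhAccept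
  rw [mul_div_mul_left _ _ hc.ne']

/-- Hence the flow-MCMC kernel is unchanged by a positive rescaling of the weight: the sampler run
with the un-normalised `e^{−S}/q̃` IS the sampler of the normalised target. -/
theorem indepMH_const_mul (q : Measure Ω) [IsProbabilityMeasure q] {w : Ω → ℝ} {c : ℝ}
    (hc : 0 < c) : indepMH q (fun x => c * w x) = indepMH q w := by
  have hE : imhAcceptE (fun x => c * w x) = imhAcceptE w := by
    funext x y
    simp only [imhAcceptE, imhAccept_const_mul hc]
  have hM : imhAcceptMass q (fun x => c * w x) = imhAcceptMass q w := by
    funext x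
    simp only [imhAcceptMass, hE]
  simp only [indepMH, hE, hM]

variable {vol : Measure Ω} {p q : Ω → ℝ}

/-- **Doeblin minorisation of the flow sampler from a weight bound.**  Densities `p` (target) and
`q̃` (model) against `vol`, positive and measurable, `q̃ · vol` a probability law; if `p ≤ M q̃`
pointwise then from EVERY state `x`: `M⁻¹ · (p·vol)(B) ≤ K(x, B)`. -/
theorem flowMCMC_minorisation (hp : Measurable p) (hq : Measurable q) (hp0 : ∀ x, 0 < p x)
    (hq0 : ∀ x, 0 < q x) [IsProbabilityMeasure (vol.withDensity fun x => ENNReal.ofReal (q x))]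
    {M : ℝ} (hM : ∀ x, p x ≤ M * q x) (x : Ω) {B : Set Ω} (hB : MeasurableSet B) :
    (ENNReal.ofReal M)⁻¹ * (vol.withDensity fun x => ENNReal.ofReal (p x)) B
      ≤ indepMH (vol.withDensity fun x => ENNReal.ofReal (q x)) (fun x => p x / q x) x B := by
  rw [← target_eq_model_withDensity hp hq hq0]
  exact indepMH_apply_ge (hp.div hq) (fun x => div_pos (hp0 x) (hq0 x))
    (fun x => (div_le_iff₀ (hq0 x)).2 (hM x)) x hB

/-- Under `p ≤ M q̃` with `p · vol`, `q̃ · vol` probability laws, `1 ≤ M`. -/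
theorem one_le_of_density_le (hq : Measurable q) (hq0 : ∀ x, 0 < q x)
    [IsProbabilityMeasure (vol.withDensity fun x => ENNReal.ofReal (q x))]
    [IsProbabilityMeasure (vol.withDensity fun x => ENNReal.ofReal (p x))]
    {M : ℝ} (hM : ∀ x, p x ≤ M * q x) : 1 ≤ M := by
  have h1 : ∫⁻ x, ENNReal.ofReal (p x) ∂vol = 1 := by
    rw [← Measure.restrict_univ (μ := vol), ← withDensity_apply _ MeasurableSet.univ]
    exact measure_univ
  have h2 : ∫⁻ x, ENNReal.ofReal (q x) ∂vol = 1 := by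
    rw [← Measure.restrict_univ (μ := vol), ← withDensity_apply _ MeasurableSet.univ]
    exact measure_univ
  have hM0 : 0 ≤ M := by
    by_contra hneg
    have hneg' : M < 0 := lt_of_not_ge hneg
    -- `ofReal (p x) ≤ ofReal (M q x) = 0` for all `x` would give `∫ p = 0 ≠ 1`
    have hall : ∀ x, ENNReal.ofReal (p x) = 0 := fun x =>
      ENNReal.ofReal_eq_zero.2 ((hM x).trans (mul_nonpos_of_nonpos_of_nonneg hneg'.le (hq0 x).le))
    have : ∫⁻ x, ENNReal.ofReal (p x) ∂vol = 0 := by simp [hall]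
    exact one_ne_zero (h1.symm.trans this)
  have h3 : (1 : ℝ≥0∞) ≤ ENNReal.ofReal M := by
    calc (1 : ℝ≥0∞) = ∫⁻ x, ENNReal.ofReal (p x) ∂vol := h1.symm
      _ ≤ ∫⁻ x, ENNReal.ofReal M * ENNReal.ofReal (q x) ∂vol := by
          refine lintegral_mono fun x => ?_
          rw [← ENNReal.ofReal_mul hM0]
          exact ENNReal.ofReal_le_ofReal (hM x)
      _ = ENNReal.ofReal M := by
          rw [lintegral_const_mul _ hq.ennreal_ofReal, h2, mul_one]
  exact ENNReal.one_le_ofReal.1 h3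

/-- **Uniform ergodicity of flow MCMC from a bounded importance weight** (the sufficiency half of
Mengersen–Tweedie's criterion, with Doeblin's rate).  Target `π = p · vol` and model `q̃ · vol`
probability laws with positive measurable densities; if `p ≤ M q̃` pointwise (`sup p/q̃ ≤ M`), then
for every initial law `μ`, every `t` and every set `A`:
`|μKᵗ(A) − π(A)| ≤ (1 − M⁻¹)ᵗ` for the flow sampler `K = indepMH (q̃·vol) (p/q̃)`. -/
theorem flowMCMC_uniformly_ergodic (hp : Measurable p) (hq : Measurable q) (hp0 : ∀ x, 0 < p x)
    (hq0 : ∀ x, 0 < q x) [IsProbabilityMeasure (vol.withDensity fun x => ENNReal.ofReal (q x))]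
    [IsProbabilityMeasure (vol.withDensity fun x => ENNReal.ofReal (p x))]
    {M : ℝ} (hM : ∀ x, p x ≤ M * q x) (μ : Measure Ω) [IsProbabilityMeasure μ] (t : ℕ)
    (A : Set Ω) :
    |((fun m : Measure Ω => m.bind (indepMH (vol.withDensity fun x => ENNReal.ofReal (q x))
        (fun x => p x / q x)))^[t] μ).real A
        - (vol.withDensity fun x => ENNReal.ofReal (p x)).real A| ≤ (1 - M⁻¹) ^ t := by
  haveI : Fact (Measurable fun x => p x / q x) := ⟨hp.div hq⟩
  have h1M : 1 ≤ M := one_le_of_density_le (vol := vol) (p := p) hq hq0 hM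
  have hε1 : (ENNReal.ofReal M)⁻¹ ≤ 1 := ENNReal.inv_le_one.2 (ENNReal.one_le_ofReal.2 h1M)
  have hinv : Kernel.Invariant (indepMH (vol.withDensity fun x => ENNReal.ofReal (q x))
      fun x => p x / q x) (vol.withDensity fun x => ENNReal.ofReal (p x)) :=
    flowMCMC_invariant (vol := vol) hp hq hp0 hq0
  have h := Literature.Probability.MarkovChains.Doeblin.doeblin_iterate_sub_invariant_le
    (κ := indepMH (vol.withDensity fun x => ENNReal.ofReal (q x)) fun x => p x / q x)
    (ν := vol.withDensity fun x => ENNReal.ofReal (p x)) (ε := (ENNReal.ofReal M)⁻¹)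
    (fun x B hB => flowMCMC_minorisation hp hq hp0 hq0 hM x hB) hε1 hinv μ t A
  rwa [ENNReal.toReal_inv, ENNReal.toReal_ofReal (zero_le_one.trans h1M)] at h

/-- **Acceptance floor.**  Under the same weight bound the sampler accepts from EVERY state with
probability at least `M⁻¹`: `M⁻¹ ≤ A(x) = ∫ min(1, w(y)/w(x)) q̃(dy)`. -/
theorem flowMCMC_acceptMass_ge (hp : Measurable p) (hq : Measurable q) (hp0 : ∀ x, 0 < p x)
    (hq0 : ∀ x, 0 < q x) [IsProbabilityMeasure (vol.withDensity fun x => ENNReal.ofReal (p x))]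
    {M : ℝ} (hM : ∀ x, p x ≤ M * q x) (x : Ω) :
    (ENNReal.ofReal M)⁻¹
      ≤ imhAcceptMass (vol.withDensity fun x => ENNReal.ofReal (q x)) (fun x => p x / q x) x := by
  have hMpos : 0 < M := by
    have h := hM x
    have : 0 < M * q x := (hp0 x).trans_le h
    exact pos_of_mul_pos_left this (hq0 x).le
  have hw0 : ∀ y, 0 < p y / q y := fun y => div_pos (hp0 y) (hq0 y)
  have hwM : ∀ y, p y / q y ≤ M := fun y => (div_le_iff₀ (hq0 y)).2 (hM y)
  unfold imhAcceptMass
  calc (ENNReal.ofReal M)⁻¹ = (ENNReal.ofReal M)⁻¹ * ∫⁻ y, ENNReal.ofReal (p y) ∂vol := by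
        rw [← Measure.restrict_univ (μ := vol), ← withDensity_apply _ MeasurableSet.univ,
          measure_univ, mul_one]
    _ = ∫⁻ y, ENNReal.ofReal (p y / q y / M) ∂vol.withDensity fun x => ENNReal.ofReal (q x) := by
        have hg : Measurable fun y => ENNReal.ofReal (p y / q y / M) :=
          ((hp.div hq).div_const M).ennreal_ofReal
        rw [lintegral_withDensity_eq_lintegral_mul _ hq.ennreal_ofReal hg,
          ← lintegral_const_mul _ hp.ennreal_ofReal]
        refine lintegral_congr fun y => ?_
        simp only [Pi.mul_apply]
        rw [← ENNReal.ofReal_mul (hq0 y).le, ← ENNReal.ofReal_inv_of_pos hMpos,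
          ← ENNReal.ofReal_mul (inv_nonneg.2 hMpos.le)]
        congr 1
        have hqy : q y ≠ 0 := (hq0 y).ne'
        field_simp
    _ ≤ ∫⁻ y, imhAcceptE (fun x => p x / q x) x y ∂vol.withDensity fun x => ENNReal.ofReal (q x) :=
        lintegral_mono fun y => imhAcceptE_ge_of_le hw0 hwM x y

end General

/-! ## §2. The lattice: the φ⁴ flow sampler -/

section Lattice

open Summit.Ventures.LatticeQCDFlow.Scoring

variable {n : ℕ}

/-- The φ⁴ Gibbs PROBABILITY measure `Z⁻¹ e^{−S(φ)} dφ` on `ℝ^Λ`, `Λ = Fin (n+1)` (density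
`gibbsWeight / gibbsZ` against Lebesgue measure). -/
noncomputable def phi4GibbsMeasure (J : Fin (n + 1) → Fin (n + 1) → ℝ) (lam : ℝ) :
    Measure (Fin (n + 1) → ℝ) :=
  volume.withDensity fun φ => ENNReal.ofReal (gibbsWeight J lam φ / gibbsZ J lam)

/-- The flow MODEL law `q̃(φ) dφ` of a model with density `q̃` against Lebesgue measure. -/
noncomputable def flowModel (q : (Fin (n + 1) → ℝ) → ℝ) : Measure (Fin (n + 1) → ℝ) :=
  volume.withDensity fun φ => ENNReal.ofReal (q φ)

/-- **The S0-A flow sampler as a Markov kernel on `ℝ^Λ`**: propose `φ' ∼ q̃ dφ'` from the flow,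
accept with `min(1, w(φ')/w(φ))`, `w = e^{−S}/q̃` (the un-normalised weight the code evaluates),
else stay — row 30's `indepMH` specialised. -/
noncomputable def phi4FlowKernel (J : Fin (n + 1) → Fin (n + 1) → ℝ) (lam : ℝ)
    (q : (Fin (n + 1) → ℝ) → ℝ) [IsProbabilityMeasure (flowModel q)] :
    Kernel (Fin (n + 1) → ℝ) (Fin (n + 1) → ℝ) :=
  indepMH (flowModel q) fun φ => gibbsWeight J lam φ / q φ

/-- For `λ > 0` (any real `J`) the Gibbs measure is a probability measure. -/
theorem isProbabilityMeasure_phi4GibbsMeasure {lam : ℝ} (hlam : 0 < lam)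
    (J : Fin (n + 1) → Fin (n + 1) → ℝ) : IsProbabilityMeasure (phi4GibbsMeasure J lam) := by
  have hZ := gibbsZ_pos hlam J
  refine ⟨?_⟩
  rw [phi4GibbsMeasure, withDensity_apply _ MeasurableSet.univ, Measure.restrict_univ,
    ← ofReal_integral_eq_lintegral_ofReal ((integrable_gibbsWeight hlam J).div_const _)
      (Filter.Eventually.of_forall fun φ => div_nonneg (gibbsWeight_pos J lam φ).le hZ.le),
    integral_div]
  unfold gibbsZ
  rw [div_self (ne_of_gt (by simpa [gibbsZ] using hZ)), ENNReal.ofReal_one]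

/-- A positive density integrating to one defines a probability model law. -/
theorem isProbabilityMeasure_flowModel {q : (Fin (n + 1) → ℝ) → ℝ} (hq0 : ∀ φ, 0 < q φ)
    (hqi : Integrable q) (hq1 : ∫ φ, q φ = 1) : IsProbabilityMeasure (flowModel q) := by
  refine ⟨?_⟩
  rw [flowModel, withDensity_apply _ MeasurableSet.univ, Measure.restrict_univ,
    ← ofReal_integral_eq_lintegral_ofReal hqi (Filter.Eventually.of_forall fun φ => (hq0 φ).le),
    hq1, ENNReal.ofReal_one]

/-- **Glue to row 2's integrated form**: expectations in `phi4GibbsMeasure` are the `gibbsExpect` of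
`Scoring/SchwingerDysonPhi4Gibbs.lean` (`⟨f⟩ = Z⁻¹ ∫ f e^{−S}`), for every observable `f`. -/
theorem integral_phi4GibbsMeasure (J : Fin (n + 1) → Fin (n + 1) → ℝ) (lam : ℝ)
    (f : (Fin (n + 1) → ℝ) → ℝ) :
    ∫ φ, f φ ∂(phi4GibbsMeasure J lam) = gibbsExpect J lam f := by
  have hZ0 : 0 ≤ gibbsZ J lam := integral_nonneg fun φ => (gibbsWeight_pos J lam φ).le
  rw [phi4GibbsMeasure, integral_withDensity_eq_integral_toReal_smul
    ((continuous_gibbsWeight J lam).measurable.div_const _).ennreal_ofReal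
    (Filter.Eventually.of_forall fun _ => ENNReal.ofReal_lt_top)]
  unfold gibbsExpect
  rw [← integral_div]
  refine integral_congr_ae (Filter.Eventually.of_forall fun φ => ?_)
  dsimp only
  rw [ENNReal.toReal_ofReal (div_nonneg (gibbsWeight_pos J lam φ).le hZ0), smul_eq_mul]
  ring

/-- **THE φ⁴ FLOW SAMPLER IS UNIFORMLY ERGODIC FOR A BOUNDED NORMALISED WEIGHT.**  `λ > 0`, any
real `J`; model density `q̃ > 0` measurable with `∫ q̃ = 1`; weight bound `e^{−S} ≤ W·Z·q̃`
(`sup (Z⁻¹e^{−S})/q̃ ≤ W`).  Then (i) the Gibbs probability measure is invariant (exactness) and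
(ii) for every initial law `μ`, every `t`, every set `A`: `|μKᵗ(A) − π(A)| ≤ (1 − W⁻¹)ᵗ`. -/
theorem phi4FlowSampler_uniformly_ergodic {lam : ℝ} (hlam : 0 < lam)
    (J : Fin (n + 1) → Fin (n + 1) → ℝ) {q : (Fin (n + 1) → ℝ) → ℝ} (hq0 : ∀ φ, 0 < q φ)
    (hqm : Measurable q) (hqi : Integrable q) (hq1 : ∫ φ, q φ = 1) {W : ℝ}
    (hW : ∀ φ, gibbsWeight J lam φ ≤ W * gibbsZ J lam * q φ) :
    haveI := isProbabilityMeasure_flowModel hq0 hqi hq1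
    Kernel.Invariant (phi4FlowKernel J lam q) (phi4GibbsMeasure J lam) ∧
      ∀ (μ : Measure (Fin (n + 1) → ℝ)) [IsProbabilityMeasure μ] (t : ℕ)
        (A : Set (Fin (n + 1) → ℝ)),
        |((fun m : Measure (Fin (n + 1) → ℝ) => m.bind (phi4FlowKernel J lam q))^[t] μ).real A
            - (phi4GibbsMeasure J lam).real A| ≤ (1 - W⁻¹) ^ t := by
  haveI := isProbabilityMeasure_flowModel hq0 hqi hq1
  haveI := isProbabilityMeasure_phi4GibbsMeasure hlam J
  have hZ := gibbsZ_pos hlam J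
  -- the normalised target density
  set p : (Fin (n + 1) → ℝ) → ℝ := fun φ => gibbsWeight J lam φ / gibbsZ J lam with hp
  have hpm : Measurable p := (continuous_gibbsWeight J lam).measurable.div_const _
  have hp0 : ∀ φ, 0 < p φ := fun φ => div_pos (gibbsWeight_pos J lam φ) hZ
  have hpW : ∀ φ, p φ ≤ W * q φ := fun φ => by
    simp only [hp]
    rw [div_le_iff₀ hZ]
    calc gibbsWeight J lam φ ≤ W * gibbsZ J lam * q φ := hW φ
      _ = W * q φ * gibbsZ J lam := by ring
  haveI hP : IsProbabilityMeasure (volume.withDensity fun φ => ENNReal.ofReal (p φ)) :=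
    isProbabilityMeasure_phi4GibbsMeasure hlam J
  haveI hQ : IsProbabilityMeasure (volume.withDensity fun φ => ENNReal.ofReal (q φ)) :=
    isProbabilityMeasure_flowModel hq0 hqi hq1
  -- the code's kernel (un-normalised weight) IS the kernel of the normalised target
  have hker : phi4FlowKernel J lam q
      = indepMH (volume.withDensity fun φ => ENNReal.ofReal (q φ)) fun φ => p φ / q φ := by
    have e : (fun φ => p φ / q φ) = fun φ => (gibbsZ J lam)⁻¹ * (gibbsWeight J lam φ / q φ) := by
      funext φ
      simp only [hp]
      field_simp
    rw [e, indepMH_const_mul _ (inv_pos.2 hZ)]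
    rfl
  refine ⟨?_, fun μ _ t A => ?_⟩
  · rw [hker]
    exact flowMCMC_invariant hpm hqm hp0 hq0
  · rw [hker]
    exact flowMCMC_uniformly_ergodic hpm hqm hp0 hq0 hpW μ t A

end Lattice

end Summit.Ventures.LatticeQCDFlow.Exactness
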